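import Literature.Topology.FourManifolds.FishtailBaseCharts
import Literature.Topology.FourManifolds.FishtailZoneNorth
import Literature.Topology.FourManifolds.PiecewiseGlue
import HarnessLib

/-!
# From the angular form of the tube over Gompf's disc to the cap-chart form

Infrastructure for the explicit fishtail neighbourhood (R. Gompf, *More Cappell–Shaneson spheres
are standard*, Algebr. Geom. Topol. 10 (2010), proof of Thm 2.1 and Lemma 2.2; the named fact
`Literature.Topology.FourManifolds.gompf2010_framedTwist`). The zone maps of the tube over the
part `D⁰` of Gompf's disc are written in the angular form `F (n, ϑ, a, b)` (latitude `n`, base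
angle `ϑ ∈ ℝ`, `2π`-periodic in `ϑ`; `FishtailBaseCharts.lean`). The position on `D⁰` near the
north cap is a point `d ≠ 0` of the cap chart, `n = capN ε d`, `ϑ = arg d`. This file passes from
one form to the other and glues along a real-valued function:

* `Literature.Topology.FourManifolds.polarForm ε F (d, a, b) = F (capN ε d, arg d, a, b)`;
  for `F` `2π`-periodic in `ϑ`, near the slit `arg d` may be replaced by `arg (-d) + π`
  (`polarForm_eventuallyEq_neg`), so `polarForm` is smooth / a local diffeomorphism at every
  `d ≠ 0` where `F` is (`contMDiffAt_polarForm`, `isLocalDiffeomorphAt_polarForm`, and the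
  pointwise versions `…'` needing `F` only at `(capN ε d, arg d, a, b)`);
* `Literature.Topology.FourManifolds.glueBy τ s f g q = if τ q < s then f q else g q` — the
  two-piece combinator along a continuous function `τ` (e.g. `‖d‖`), with the germ, smoothness,
  local-diffeomorphism and injectivity lemmas of `glue2` (`PiecewiseGlue.lean`).

Everything is proved; no named facts.

## References

* R. E. Gompf, *More Cappell–Shaneson spheres are standard*, Algebr. Geom. Topol. 10 (2010)
  1665–1681, proof of Thm 2.1 and Lemma 2.2. [GompfAGT2010]
-/

noncomputable section

open scoped Real ContDiff Topology Manifold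
open Set Function Filter Complex

namespace Literature.Topology.FourManifolds

/-! ### Gluing along a function -/

section GlueBy

variable {Q : Type*} {N : Type*} (τ : Q → ℝ) (s : ℝ) (f g : Q → N)

/-- **The two-piece combinator along a function** `τ`. [folklore] -/
def glueBy (q : Q) : N := by
  classical
  exact if τ q < s then f q else g q

variable {τ s f g}

/-- Left of the breakpoint the glued map is `f`. [folklore] -/
theorem glueBy_of_lt {q : Q} (h : τ q < s) : glueBy τ s f g q = f q := by rw [glueBy, if_pos h]

/-- Right of the breakpoint the glued map is `g`. [folklore] -/
theorem glueBy_of_le {q : Q} (h : s ≤ τ q) : glueBy τ s f g q = g q := by rw [glueBy, if_neg (not_lt.2 h)]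

/-- On an agreement slab the glued map is `g`. [folklore] -/
theorem glueBy_of_agree {δ : ℝ} (hfg : ∀ q, |τ q - s| < δ → f q = g q) {q : Q} (h : |τ q - s| < δ) :
    glueBy τ s f g q = g q := by
  rcases lt_or_ge (τ q) s with hl | hr
  · rw [glueBy_of_lt hl, hfg q h]
  · exact glueBy_of_le hr

variable [TopologicalSpace Q]

/-- **The glued map is locally one of the pieces**, for continuous `τ` and an agreement slab. [folklore] -/
theorem glueBy_eventuallyEq (hτ : Continuous τ) {δ : ℝ} (hδ : 0 < δ) (hfg : ∀ q, |τ q - s| < δ → f q = g q) (q : Q) :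
    (τ q < s ∧ glueBy τ s f g =ᶠ[𝓝 q] f) ∨ (s - δ < τ q ∧ glueBy τ s f g =ᶠ[𝓝 q] g) := by
  rcases lt_or_ge (τ q) (s - δ / 2) with hl | hr
  · refine Or.inl ⟨by linarith, ?_⟩
    have ho : IsOpen {q : Q | τ q < s} := isOpen_lt hτ continuous_const
    exact eventuallyEq_of_mem (ho.mem_nhds (show τ q < s by linarith)) fun q' hq' ↦ glueBy_of_lt hq'
  · refine Or.inr ⟨by linarith, ?_⟩
    rcases lt_or_ge (τ q) (s + δ / 2) with hm | hbig
    · have ho : IsOpen {q : Q | |τ q - s| < δ} := isOpen_lt (continuous_abs.comp (hτ.sub continuous_const)) continuous_const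
      exact eventuallyEq_of_mem (ho.mem_nhds (show |τ q - s| < δ from abs_lt.2 ⟨by linarith, by linarith⟩))
        fun q' hq' ↦ glueBy_of_agree hfg hq'
    · have ho : IsOpen {q : Q | s < τ q} := isOpen_lt continuous_const hτ
      exact eventuallyEq_of_mem (ho.mem_nhds (show s < τ q by linarith)) fun q' hq' ↦ glueBy_of_le (le_of_lt hq')

end GlueBy

section GlueBySmooth

variable {E H : Type*} [NormedAddCommGroup E] [NormedSpace ℝ E] [TopologicalSpace H] {J : ModelWithCorners ℝ E H}
  {N : Type*} [TopologicalSpace N] [ChartedSpace H N]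
  {F : Type*} [NormedAddCommGroup F] [NormedSpace ℝ F]
  {τ : F → ℝ} {s : ℝ} {f g : F → N}

/-- **Smoothness of the glued map** from smoothness of the relevant piece. [folklore] -/
theorem contMDiffAt_glueBy (hτ : Continuous τ) {δ : ℝ} (hδ : 0 < δ) (hfg : ∀ q, |τ q - s| < δ → f q = g q) {q : F}
    (hf : τ q < s → ContMDiffAt 𝓘(ℝ, F) J ∞ f q) (hg : s - δ < τ q → ContMDiffAt 𝓘(ℝ, F) J ∞ g q) :
    ContMDiffAt 𝓘(ℝ, F) J ∞ (glueBy τ s f g) q := by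
  rcases glueBy_eventuallyEq hτ hδ hfg q with ⟨h1, h2⟩ | ⟨h1, h2⟩
  · exact (hf h1).congr_of_eventuallyEq h2
  · exact (hg h1).congr_of_eventuallyEq h2

/-- **The glued map is a local diffeomorphism** where the relevant piece is. [folklore] -/
theorem isLocalDiffeomorphAt_glueBy (hτ : Continuous τ) {δ : ℝ} (hδ : 0 < δ) (hfg : ∀ q, |τ q - s| < δ → f q = g q)
    {q : F} (hf : τ q < s → IsLocalDiffeomorphAt 𝓘(ℝ, F) J ∞ f q)
    (hg : s - δ < τ q → IsLocalDiffeomorphAt 𝓘(ℝ, F) J ∞ g q) :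
    IsLocalDiffeomorphAt 𝓘(ℝ, F) J ∞ (glueBy τ s f g) q := by
  rcases glueBy_eventuallyEq hτ hδ hfg q with ⟨h1, h2⟩ | ⟨h1, h2⟩
  · exact isLocalDiffeomorphAt_congr_nhds' (hf h1) h2
  · exact isLocalDiffeomorphAt_congr_nhds' (hg h1) h2

end GlueBySmooth

section GlueByInj

variable {Q : Type*} {N : Type*} {τ : Q → ℝ} {s : ℝ} {f g : Q → N}

/-- **Injectivity of the glued map** on `S`: injectivity of `f` on `S ∩ {τ < s + δ}`, of `g` on
`S ∩ {s ≤ τ}`, agreement on the slab, separation of the far parts. [folklore] -/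
theorem injOn_glueBy {S : Set Q} {δ : ℝ} (hδ : 0 < δ) (hfg : ∀ q, |τ q - s| < δ → f q = g q)
    (hf : InjOn f (S ∩ {q | τ q < s + δ})) (hg : InjOn g (S ∩ {q | s ≤ τ q}))
    (hsep : ∀ q ∈ S, ∀ q' ∈ S, τ q < s → s + δ ≤ τ q' → f q ≠ g q') :
    InjOn (glueBy τ s f g) S := by
  have key : ∀ q ∈ S, ∀ q' ∈ S, τ q ≤ τ q' → glueBy τ s f g q = glueBy τ s f g q' → q = q' := by
    intro q hq q' hq' hle heq
    rcases lt_or_ge (τ q') s with h' | h'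
    · rw [glueBy_of_lt (lt_of_le_of_lt hle h'), glueBy_of_lt h'] at heq
      exact hf ⟨hq, by show τ q < s + δ; linarith⟩ ⟨hq', by show τ q' < s + δ; linarith⟩ heq
    · rcases lt_or_ge (τ q) s with h | h
      · rw [glueBy_of_lt h, glueBy_of_le h'] at heq
        rcases lt_or_ge (τ q') (s + δ) with h1 | h1
        · rw [← hfg q' (abs_lt.2 ⟨by linarith, by linarith⟩)] at heq
          exact hf ⟨hq, by show τ q < s + δ; linarith⟩ ⟨hq', h1⟩ heq
        · exact absurd heq (hsep q hq q' hq' h h1)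
      · rw [glueBy_of_le h, glueBy_of_le h'] at heq
        exact hg ⟨hq, h⟩ ⟨hq', h'⟩ heq
  intro q hq q' hq' heq
  rcases le_total (τ q) (τ q') with h | h
  · exact key q hq q' hq' h heq
  · exact (key q' hq' q hq h heq.symm).symm

end GlueByInj

/-! ### The polar form -/

section PolarForm

variable (ε : ℝ) {M : Type*} (F : ℝ × ℝ × ℝ × ℝ → M)

/-- **The cap-chart form of an angular zone map**: `(d, a, b) ↦ F (capN ε d, arg d, a, b)`. [folklore] -/
def polarForm (q : ℂ × ℝ × ℝ) : M := F (capN ε q.1, arg q.1, q.2)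

variable {ε F}

/-- The value of the polar form. [folklore] -/
theorem polarForm_apply (q : ℂ × ℝ × ℝ) : polarForm ε F q = F (capN ε q.1, arg q.1, q.2) := rfl

/-- **Near the slit the angle may be read off `-d`**: if `F` is `2π`-periodic in `ϑ`, then
`polarForm ε F = fun q ↦ F (capN ε q.1, arg (-q.1) + π, q.2)` near every `d` with `re d < 0`. [folklore] -/
theorem polarForm_eventuallyEq_neg (hper : ∀ n ϑ (w : ℝ × ℝ), F (n, ϑ + 2 * π, w) = F (n, ϑ, w)) {q : ℂ × ℝ × ℝ}
    (hre : q.1.re < 0) :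
    polarForm ε F =ᶠ[𝓝 q] fun q' ↦ F (capN ε q'.1, arg (-q'.1) + π, q'.2) := by
  have ho : IsOpen {q' : ℂ × ℝ × ℝ | q'.1.re < 0} := isOpen_lt (continuous_re.comp continuous_fst) continuous_const
  filter_upwards [ho.mem_nhds hre] with q' hq'
  simp only [polarForm]
  have hq'' : q'.1.re < 0 := hq'
  rcases lt_trichotomy q'.1.im 0 with him | him | him
  · -- `im < 0`: `arg (-d) = arg d + π`, so `arg d = (arg (-d) + π) - 2π`; then periodicity
    rw [arg_neg_eq_arg_add_pi_of_im_neg him, show arg q'.1 + π + π = arg q'.1 + 2 * π by ring, hper]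
  · -- `im = 0`, `re < 0`: `arg d = π`, `arg (-d) = 0`
    have hd : q'.1 = ((q'.1.re : ℝ) : ℂ) := Complex.ext (by simp) (by simp [him])
    have h1 : arg q'.1 = π := by rw [hd]; exact arg_ofReal_of_neg hq''
    have h2 : arg (-q'.1) = 0 := by
      rw [hd, ← ofReal_neg]; exact arg_ofReal_of_nonneg (by linarith)
    rw [h1, h2, zero_add]
  · -- `im > 0`: `arg (-d) = arg d - π`
    rw [arg_neg_eq_arg_sub_pi_of_im_pos him, sub_add_cancel]

variable {E H : Type*} [NormedAddCommGroup E] [NormedSpace ℝ E] [TopologicalSpace H] {J : ModelWithCorners ℝ E H}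
  [TopologicalSpace M] [ChartedSpace H M]

/-- The map `d ↦ (capN ε d, arg d)` is a local diffeomorphism on the slit plane. [folklore] -/
theorem isLocalDiffeomorphAt_capN_arg (hε : 0 < ε) {d : ℂ} (hd : d ∈ slitPlane) :
    IsLocalDiffeomorphAt 𝓘(ℝ, ℂ) 𝓘(ℝ, ℝ × ℝ) ∞ (fun d ↦ (capN ε d, arg d)) d := by
  -- `(capN d, arg d) = A (capChart d)` with `A (n, s) = (n, 2π (s - 1))`
  let A : (ℝ × ℝ) ≃ₘ⟮𝓘(ℝ, ℝ × ℝ), 𝓘(ℝ, ℝ × ℝ)⟯ (ℝ × ℝ) :=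
    { toFun := fun p ↦ (p.1, 2 * π * (p.2 - 1))
      invFun := fun p ↦ (p.1, p.2 / (2 * π) + 1)
      left_inv := fun p ↦ by
        obtain ⟨n, s⟩ := p
        simp only [Prod.mk.injEq, true_and]
        field_simp; ring
      right_inv := fun p ↦ by
        obtain ⟨n, s⟩ := p
        simp only [Prod.mk.injEq, true_and]
        field_simp; ring
      contMDiff_toFun := contMDiff_iff_contDiff.2 (contDiff_fst.prodMk (contDiff_const.mul (contDiff_snd.sub contDiff_const)))
      contMDiff_invFun := contMDiff_iff_contDiff.2 (contDiff_fst.prodMk ((contDiff_snd.div_const _).add contDiff_const)) }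
  have h1 := isLocalDiffeomorphAt_capChart hε hd
  have h2 := A.isLocalDiffeomorph (capN ε d, capS d)
  have h := h1.comp (K := 𝓘(ℝ, ℝ × ℝ)) (P := ℝ × ℝ) h2
  refine isLocalDiffeomorphAt_congr_nhds' h (Eventually.of_forall fun d' ↦ ?_)
  show (capN ε d', arg d') = (capN ε d', 2 * π * (capS d' - 1))
  simp only [capS, Prod.mk.injEq, true_and]
  field_simp
  ring

/-- The map `(d, a, b) ↦ (capN ε d, arg d, a, b)` is a local diffeomorphism on the slit plane. [folklore] -/
theorem isLocalDiffeomorphAt_capN_arg_prod (hε : 0 < ε) {q : ℂ × ℝ × ℝ} (hd : q.1 ∈ slitPlane) :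
    IsLocalDiffeomorphAt 𝓘(ℝ, ℂ × ℝ × ℝ) 𝓘(ℝ, ℝ × ℝ × ℝ × ℝ) ∞ (fun q : ℂ × ℝ × ℝ ↦ (capN ε q.1, arg q.1, q.2)) q := by
  have h : IsLocalDiffeomorphAt 𝓘(ℝ, ℂ × ℝ × ℝ) 𝓘(ℝ, (ℝ × ℝ) × (ℝ × ℝ)) ∞
      (fun q : ℂ × ℝ × ℝ ↦ ((capN ε q.1, arg q.1), q.2)) q := by
    have h := IsLocalDiffeomorphAt.prodMap' (isLocalDiffeomorphAt_capN_arg hε hd)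
      ((Diffeomorph.refl 𝓘(ℝ, ℝ × ℝ) (ℝ × ℝ) ∞).isLocalDiffeomorph q.2)
    rw [← modelWithCornersSelf_prod, ← modelWithCornersSelf_prod, chartedSpaceSelf_prod, chartedSpaceSelf_prod] at h
    exact h
  -- reassociate `((n, ϑ), (a, b)) ↦ (n, ϑ, a, b)`
  let R : ((ℝ × ℝ) × (ℝ × ℝ)) ≃ₘ⟮𝓘(ℝ, (ℝ × ℝ) × (ℝ × ℝ)), 𝓘(ℝ, ℝ × ℝ × ℝ × ℝ)⟯ (ℝ × ℝ × ℝ × ℝ) :=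
    { toFun := fun p ↦ (p.1.1, p.1.2, p.2)
      invFun := fun p ↦ ((p.1, p.2.1), p.2.2)
      left_inv := fun _ ↦ rfl
      right_inv := fun _ ↦ rfl
      contMDiff_toFun := contMDiff_iff_contDiff.2 ((contDiff_fst.comp contDiff_fst).prodMk
        ((contDiff_snd.comp contDiff_fst).prodMk contDiff_snd))
      contMDiff_invFun := contMDiff_iff_contDiff.2 ((contDiff_fst.prodMk (contDiff_fst.comp contDiff_snd)).prodMk
        (contDiff_snd.comp contDiff_snd)) }
  have hR := R.isLocalDiffeomorph ((capN ε q.1, arg q.1), q.2)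
  have h' := h.comp (K := 𝓘(ℝ, ℝ × ℝ × ℝ × ℝ)) (P := ℝ × ℝ × ℝ × ℝ) hR
  exact isLocalDiffeomorphAt_congr_nhds' h' (Eventually.of_forall fun q' ↦ rfl)

/-- The same maps read off `-d`: `(d, a, b) ↦ (capN ε d, arg (-d) + π, a, b)` is a local
diffeomorphism where `-d` is in the slit plane. [folklore] -/
theorem isLocalDiffeomorphAt_capN_arg_neg_prod (hε : 0 < ε) {q : ℂ × ℝ × ℝ} (hd : -q.1 ∈ slitPlane) :
    IsLocalDiffeomorphAt 𝓘(ℝ, ℂ × ℝ × ℝ) 𝓘(ℝ, ℝ × ℝ × ℝ × ℝ) ∞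
      (fun q : ℂ × ℝ × ℝ ↦ (capN ε q.1, arg (-q.1) + π, q.2)) q := by
  -- negate `d`, apply the previous map, shift the angle
  let Ng : (ℂ × ℝ × ℝ) ≃ₘ⟮𝓘(ℝ, ℂ × ℝ × ℝ), 𝓘(ℝ, ℂ × ℝ × ℝ)⟯ (ℂ × ℝ × ℝ) :=
    { toFun := fun q ↦ (-q.1, q.2)
      invFun := fun q ↦ (-q.1, q.2)
      left_inv := fun q ↦ by simp
      right_inv := fun q ↦ by simp
      contMDiff_toFun := contMDiff_iff_contDiff.2 (contDiff_fst.neg.prodMk contDiff_snd)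
      contMDiff_invFun := contMDiff_iff_contDiff.2 (contDiff_fst.neg.prodMk contDiff_snd) }
  let Sh : (ℝ × ℝ × ℝ × ℝ) ≃ₘ⟮𝓘(ℝ, ℝ × ℝ × ℝ × ℝ), 𝓘(ℝ, ℝ × ℝ × ℝ × ℝ)⟯ (ℝ × ℝ × ℝ × ℝ) :=
    { toFun := fun p ↦ (p.1, p.2.1 + π, p.2.2)
      invFun := fun p ↦ (p.1, p.2.1 - π, p.2.2)
      left_inv := fun p ↦ by simp
      right_inv := fun p ↦ by simp
      contMDiff_toFun := contMDiff_iff_contDiff.2 (contDiff_fst.prodMk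
        (((contDiff_fst.comp contDiff_snd).add contDiff_const).prodMk (contDiff_snd.comp contDiff_snd)))
      contMDiff_invFun := contMDiff_iff_contDiff.2 (contDiff_fst.prodMk
        (((contDiff_fst.comp contDiff_snd).sub contDiff_const).prodMk (contDiff_snd.comp contDiff_snd))) }
  have h1 := Ng.isLocalDiffeomorph q
  have h2 := isLocalDiffeomorphAt_capN_arg_prod hε (q := (-q.1, q.2)) hd
  have h3 := Sh.isLocalDiffeomorph (capN ε (-q.1), arg (-q.1), q.2)
  have h := (h1.comp (K := 𝓘(ℝ, ℝ × ℝ × ℝ × ℝ)) (P := ℝ × ℝ × ℝ × ℝ) h2).comp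
    (K := 𝓘(ℝ, ℝ × ℝ × ℝ × ℝ)) (P := ℝ × ℝ × ℝ × ℝ) h3
  refine isLocalDiffeomorphAt_congr_nhds' h (Eventually.of_forall fun q' ↦ ?_)
  show (capN ε q'.1, arg (-q'.1) + π, q'.2) = (capN ε (-q'.1), arg (-q'.1) + π, q'.2)
  rw [capN, capN, norm_neg]

/-- **The polar form is a local diffeomorphism** at `(d, a, b)`, `d ≠ 0`, when `F` is `2π`-periodic
in the angle and a local diffeomorphism at `(capN ε d, ϑ, a, b)` for every angle `ϑ`. [folklore] -/
theorem isLocalDiffeomorphAt_polarForm (hε : 0 < ε) (hper : ∀ n ϑ (w : ℝ × ℝ), F (n, ϑ + 2 * π, w) = F (n, ϑ, w))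
    {q : ℂ × ℝ × ℝ} (hd : q.1 ≠ 0)
    (hF : ∀ ϑ : ℝ, IsLocalDiffeomorphAt 𝓘(ℝ, ℝ × ℝ × ℝ × ℝ) J ∞ F (capN ε q.1, ϑ, q.2)) :
    IsLocalDiffeomorphAt 𝓘(ℝ, ℂ × ℝ × ℝ) J ∞ (polarForm ε F) q := by
  by_cases hs : q.1 ∈ slitPlane
  · have h1 := isLocalDiffeomorphAt_capN_arg_prod hε hs
    have h := h1.comp (K := J) (P := M) (hF (arg q.1))
    exact isLocalDiffeomorphAt_congr_nhds' h (Eventually.of_forall fun q' ↦ rfl)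
  · -- on the slit: `d` is a negative real; read the angle off `-d`
    have hre : q.1.re < 0 := by
      rw [mem_slitPlane_iff, not_or, not_lt, not_ne_iff] at hs
      rcases hs.1.lt_or_eq with h | h
      · exact h
      · exfalso; exact hd (Complex.ext h (by simpa using hs.2))
    have hneg : -q.1 ∈ slitPlane := by
      rw [mem_slitPlane_iff]; left; simp; linarith
    have h1 := isLocalDiffeomorphAt_capN_arg_neg_prod hε hneg
    have h := h1.comp (K := J) (P := M) (hF (arg (-q.1) + π))
    exact isLocalDiffeomorphAt_congr_nhds' h (polarForm_eventuallyEq_neg hper hre)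

/-- **Smoothness of the polar form** at `(d, a, b)`, `d ≠ 0`, when `F` is `2π`-periodic in the
angle and smooth at `(capN ε d, ϑ, a, b)` for every angle `ϑ`. [folklore] -/
theorem contMDiffAt_polarForm (hper : ∀ n ϑ (w : ℝ × ℝ), F (n, ϑ + 2 * π, w) = F (n, ϑ, w))
    {q : ℂ × ℝ × ℝ} (hd : q.1 ≠ 0)
    (hF : ∀ ϑ : ℝ, ContMDiffAt 𝓘(ℝ, ℝ × ℝ × ℝ × ℝ) J ∞ F (capN ε q.1, ϑ, q.2)) :
    ContMDiffAt 𝓘(ℝ, ℂ × ℝ × ℝ) J ∞ (polarForm ε F) q := by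
  have hN : ContDiffAt ℝ ∞ (fun q : ℂ × ℝ × ℝ ↦ capN ε q.1) q := (contDiffAt_capN ε hd).comp q contDiffAt_fst
  by_cases hs : q.1 ∈ slitPlane
  · have hA : ContDiffAt ℝ ∞ (fun q : ℂ × ℝ × ℝ ↦ arg q.1) q := (contDiffAt_arg hs).comp q contDiffAt_fst
    have hP : ContMDiffAt 𝓘(ℝ, ℂ × ℝ × ℝ) 𝓘(ℝ, ℝ × ℝ × ℝ × ℝ) ∞ (fun q : ℂ × ℝ × ℝ ↦ (capN ε q.1, arg q.1, q.2)) q :=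
      (hN.prodMk (hA.prodMk contDiffAt_snd)).contMDiffAt
    exact (hF (arg q.1)).comp q hP
  · have hre : q.1.re < 0 := by
      rw [mem_slitPlane_iff, not_or, not_lt, not_ne_iff] at hs
      rcases hs.1.lt_or_eq with h | h
      · exact h
      · exfalso; exact hd (Complex.ext h (by simpa using hs.2))
    have hneg : -q.1 ∈ slitPlane := by
      rw [mem_slitPlane_iff]; left; simp; linarith
    have hA : ContDiffAt ℝ ∞ (fun q : ℂ × ℝ × ℝ ↦ arg (-q.1) + π) q :=
      ((contDiffAt_arg hneg).comp q contDiffAt_fst.neg).add contDiffAt_const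
    have hP : ContMDiffAt 𝓘(ℝ, ℂ × ℝ × ℝ) 𝓘(ℝ, ℝ × ℝ × ℝ × ℝ) ∞
        (fun q : ℂ × ℝ × ℝ ↦ (capN ε q.1, arg (-q.1) + π, q.2)) q :=
      (hN.prodMk (hA.prodMk contDiffAt_snd)).contMDiffAt
    exact ((hF _).comp q hP).congr_of_eventuallyEq (polarForm_eventuallyEq_neg hper hre)

/-- On the slit, `arg (-d) + π = arg d` (`d` a negative real). [folklore] -/
theorem arg_neg_add_pi_of_slit {d : ℂ} (hre : d.re < 0) (him : d.im = 0) : arg (-d) + π = arg d := by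
  have hd : d = ((d.re : ℝ) : ℂ) := Complex.ext (by simp) (by simp [him])
  rw [hd, ← ofReal_neg, arg_ofReal_of_nonneg (by linarith), arg_ofReal_of_neg hre, zero_add]

/-- **The polar form is a local diffeomorphism** at `(d, a, b)`, `d ≠ 0`, when `F` is `2π`-periodic
in the angle and a local diffeomorphism at the single point `(capN ε d, arg d, a, b)`. [folklore] -/
theorem isLocalDiffeomorphAt_polarForm' (hε : 0 < ε) (hper : ∀ n ϑ (w : ℝ × ℝ), F (n, ϑ + 2 * π, w) = F (n, ϑ, w))
    {q : ℂ × ℝ × ℝ} (hd : q.1 ≠ 0)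
    (hF : IsLocalDiffeomorphAt 𝓘(ℝ, ℝ × ℝ × ℝ × ℝ) J ∞ F (capN ε q.1, arg q.1, q.2)) :
    IsLocalDiffeomorphAt 𝓘(ℝ, ℂ × ℝ × ℝ) J ∞ (polarForm ε F) q := by
  by_cases hs : q.1 ∈ slitPlane
  · have h1 := isLocalDiffeomorphAt_capN_arg_prod hε hs
    have h := h1.comp (K := J) (P := M) hF
    exact isLocalDiffeomorphAt_congr_nhds' h (Eventually.of_forall fun q' ↦ rfl)
  · have hre : q.1.re < 0 := by
      rw [mem_slitPlane_iff, not_or, not_lt, not_ne_iff] at hs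
      rcases hs.1.lt_or_eq with h | h
      · exact h
      · exfalso; exact hd (Complex.ext h (by simpa using hs.2))
    have him : q.1.im = 0 := by
      rw [mem_slitPlane_iff, not_or, not_lt, not_ne_iff] at hs
      exact hs.2
    have hneg : -q.1 ∈ slitPlane := by
      rw [mem_slitPlane_iff]; left; simp; linarith
    have h1 := isLocalDiffeomorphAt_capN_arg_neg_prod hε hneg
    have hF' : IsLocalDiffeomorphAt 𝓘(ℝ, ℝ × ℝ × ℝ × ℝ) J ∞ F (capN ε q.1, arg (-q.1) + π, q.2) := by
      rw [arg_neg_add_pi_of_slit hre him]; exact hF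
    have h := h1.comp (K := J) (P := M) hF'
    exact isLocalDiffeomorphAt_congr_nhds' h (polarForm_eventuallyEq_neg hper hre)

/-- **Smoothness of the polar form** at `(d, a, b)`, `d ≠ 0`, from smoothness of `F` at the single
point `(capN ε d, arg d, a, b)` and the periodicity. [folklore] -/
theorem contMDiffAt_polarForm' (hper : ∀ n ϑ (w : ℝ × ℝ), F (n, ϑ + 2 * π, w) = F (n, ϑ, w))
    {q : ℂ × ℝ × ℝ} (hd : q.1 ≠ 0) (hF : ContMDiffAt 𝓘(ℝ, ℝ × ℝ × ℝ × ℝ) J ∞ F (capN ε q.1, arg q.1, q.2)) :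
    ContMDiffAt 𝓘(ℝ, ℂ × ℝ × ℝ) J ∞ (polarForm ε F) q := by
  have hN : ContDiffAt ℝ ∞ (fun q : ℂ × ℝ × ℝ ↦ capN ε q.1) q := (contDiffAt_capN ε hd).comp q contDiffAt_fst
  by_cases hs : q.1 ∈ slitPlane
  · have hA : ContDiffAt ℝ ∞ (fun q : ℂ × ℝ × ℝ ↦ arg q.1) q := (contDiffAt_arg hs).comp q contDiffAt_fst
    have hP : ContMDiffAt 𝓘(ℝ, ℂ × ℝ × ℝ) 𝓘(ℝ, ℝ × ℝ × ℝ × ℝ) ∞ (fun q : ℂ × ℝ × ℝ ↦ (capN ε q.1, arg q.1, q.2)) q :=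
      (hN.prodMk (hA.prodMk contDiffAt_snd)).contMDiffAt
    exact hF.comp q hP
  · have hre : q.1.re < 0 := by
      rw [mem_slitPlane_iff, not_or, not_lt, not_ne_iff] at hs
      rcases hs.1.lt_or_eq with h | h
      · exact h
      · exfalso; exact hd (Complex.ext h (by simpa using hs.2))
    have him : q.1.im = 0 := by
      rw [mem_slitPlane_iff, not_or, not_lt, not_ne_iff] at hs
      exact hs.2
    have hneg : -q.1 ∈ slitPlane := by
      rw [mem_slitPlane_iff]; left; simp; linarith
    have hA : ContDiffAt ℝ ∞ (fun q : ℂ × ℝ × ℝ ↦ arg (-q.1) + π) q :=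
      ((contDiffAt_arg hneg).comp q contDiffAt_fst.neg).add contDiffAt_const
    have hP : ContMDiffAt 𝓘(ℝ, ℂ × ℝ × ℝ) 𝓘(ℝ, ℝ × ℝ × ℝ × ℝ) ∞
        (fun q : ℂ × ℝ × ℝ ↦ (capN ε q.1, arg (-q.1) + π, q.2)) q :=
      (hN.prodMk (hA.prodMk contDiffAt_snd)).contMDiffAt
    have hF' : ContMDiffAt 𝓘(ℝ, ℝ × ℝ × ℝ × ℝ) J ∞ F (capN ε q.1, arg (-q.1) + π, q.2) := by
      rw [arg_neg_add_pi_of_slit hre him]; exact hF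
    exact (hF'.comp q hP).congr_of_eventuallyEq (polarForm_eventuallyEq_neg hper hre)

end PolarForm

end Literature.Topology.FourManifolds
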